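import Mathlib
import HarnessLib
import HarnessLib.Audit
import Summits.QuantumFields.Statement
import Literature.MathematicalPhysics.QuantumFieldTheory.QCDOS

/-!
Route: GluonFreeDual

CLOSED (retired) 2026-08-16T07:22:03Z by planner-rchoice-QuantumFields-GluonFreeDual-st-b2bb7bf8-0 — reason: engine refuted in substance (evidence-level, no Lean theorem possible for a 64-link integral): stmt-QuantumFields-9756 DualPositiveAssociation refuted-substantive by rattack-9756 gen-1/gen-2 Monte Carlo, stmt-QuantumFields-9712 PlaquetteCov — note: route-choice (planner rchoice-GluonFreeDual-st-b2bb7bf8): RETIRE — substantive refutation of the route's ENGINE, no honest next line. Census (full text: DECISION.md, evidence on stmt-QuantumFields-9756). WITNESS: DualPositiveAssociation (stmt-9756, rank-3 crux) refuted-substantive by two independent. The file is kept as the record of this route; refuted decls are indexed as negative knowledge (`ledger negatives`).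

# Route GluonFreeDual — integrate out the gluons — the link-free dual of Wilson SU(3) lattice QCD is
a positive Loewner-monotone model; GKS-type order plus sharpness as the all-coupling engine

It suffices to show X = LatticeQCDGapAF, the lattice half of `QCDOf 2 ∧ QCDOf 3`: for N_f = 2 and
N_f = 3 there is ONE
mass-independent Wilson regularisation (a_k → 0, two-loop asymptotic scaling of β_k, a_k L_k → ∞,
m_crit(k), leading-log Z_m(k))
such that for EVERY tuple of positive renormalised quark masses the bare trajectory stays on the
physical branch and the lattice
theories have a mass gap Δ(m) > 0 in physical units, uniformly in the volume
(`QCDScheme.HasLatticeMassGap`); X → QCD through the crux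
ContinuumFromLatticeGap (the Osterwalder–Schrader / continuum legs shared with every lattice-first
line). The line that reaches X is the
card gluon-free-monotone-dual (spine), transplanted from the Budczies–Zirnbauer induced weight to
the WILSON weight the Statement pins:
Vairinhos–de Forcrand's two Hubbard–Stratonovich steps make every link enter linearly, the links are
integrated EXACTLY at every β
against the one-link kernel W(J) = ∫ e^(2Re tr JU) dU, and lattice QCD becomes a gauge-variable-free
local model of Gaussian matrix
fields (quarks: Grassmann sources inside finite Taylor polynomials of W) with POSITIVE weights whose
kernels are Schur-positive and
Loewner-MONOTONE (supports OneLinkLoewnerMonotoneU3, BaryonicHarmonicsNonneg). On that dual the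
engine was to be ORDER, not expansion: positive association plus Simon–Lieb /
Aizenman–Barsky / Duminil-Copin–Tassion sharpness, whose deliverable is crux AllCouplingClustering
(volume-uniform exponential clustering
at EVERY bare coupling in the positive-determinant sector); AllCouplingClustering feeds X through
the glue support
LatticeGapAFOfClustering : AllCouplingClustering → LatticeQCDGapAF (the asymptotic-freedom RATE,
imported and conjecture-grade).
AMENDMENT (rev 3, 2026-08-16, route-repair): the association leg is NUMERICALLY REFUTED in its
minimal form — on the 2⁴ torus at
β_W ∈ {8, 12, 16, 24} complementary-plane plaquette energies of SU(3) Wilson theory ANTICORRELATE,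
Cov(Re tr U_p, Re tr U_q) =
−2.27(5)·10⁻⁴ at β_W = 12 (two independent codes, > 20σ and 49σ, validated against the exact 2×2
character expansion and strong
coupling; the Griffiths-II response test fails at 14.8σ; evidence RESULTS.md / REPLICATION.md on
stmt-QuantumFields-9756 and -9712;
mechanism: torus zero modes redistribute the equipartitioned fluctuation action among the six
planes, O(β⁻²) per complementary pair,
predicted on every fixed torus once β exceeds a power of L, although 4⁴ and 6⁴ at β_W ≤ 16 show all
pair classes ≥ 0). The former
cruxes DualPositiveAssociation (informal, rank 3) and PlaquetteCovarianceNonneg (rank 2, L ≥ 2 as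
typed) are therefore DROPPED, not
restated: a volume floor does not return a finite-volume order structure (association is
volume-independent where it holds), and the
surviving thermodynamic-limit covariance-sign question feeds nothing in `closes`. The line now
stands on AllCouplingClustering →
LatticeGapAFOfClustering → LatticeQCDGapAF → ContinuumFromLatticeGap with the exact link-free dual
as its OBJECT (supports
OneLinkLoewnerMonotoneU3, BaryonicHarmonicsNonneg unaffected) and no all-coupling ENGINE in hand; a
tenure decision (pivot — e.g.
't Hooft-twisted tori without torons, or thermodynamic-limit-first inequalities — or closure) is
due.
Lean: `∀ Nf : ℕ, (Nf = 2 ∨ Nf = 3) → ∃ reg :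
Literature.MathematicalPhysics.QuantumFieldTheory.QCDRegularisation Nf, reg.HasMassScaling ∧ (∀ (m :
Fin Nf → ℝ) (z shift : Literature.MathematicalPhysics.QuantumFieldTheory.QCDField Nf → ℕ → ℝ),
(reg.scheme m z shift).HasAsymptoticScaling) ∧ ∀ m : Fin Nf → ℝ, (∀ f, 0 < m f) → (∀ f, ∀ᶠ k in
Filter.atTop, -1 < (reg.scheme m 0 0).mq f k) ∧ ∃ Δ : ℝ, 0 < Δ ∧ ∀ z shift :
Literature.MathematicalPhysics.QuantumFieldTheory.QCDField Nf → ℕ → ℝ, (reg.scheme m z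
shift).HasLatticeMassGap Δ`

## Assembly
Pure logic, sorry-free (`fun hL hC => ⟨hC 2 (Or.inl rfl) (hL 2 (Or.inl rfl)), hC 3 (Or.inr rfl) (hL
3 (Or.inr rfl))⟩`,
axioms propext / Classical.choice / Quot.sound): LatticeQCDGapAF gives the gapped
asymptotically-free regularisation for N_f = 2 and 3,
ContinuumFromLatticeGap turns each into QCDOf N_f, and QCD is their conjunction.
AllCouplingClustering is not a hypothesis of the deciding
theorem; it enters through the glue support LatticeGapAFOfClustering (`closes (hG hA) hC : QCD`,
checked in the planner's Sketch.lean).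
The two one-link supports are structure facts of the dual object, provable now.

Rationale: WHY THIS LINE. Every all-coupling result for non-abelian lattice gauge theory uses expansions
(Osterwalder–Seiler cluster expansion, Bałaban RG) or
group-blind comparison (Tomboulis2007Confinement, caught by MigdalKadanoffGroupBlindness); an ORDER
structure has never been available
because the Wilson weight is not a positive combination of products of positive-type link functions.
After exact link elimination
(VairinhosDeforcrand2014 for the Wilson action; BudcziesZirnbauer2003, BrandtLohmayerWettig2016 for
the induced weight — there used only as
a simulation / universality device) it is: the U(N) one-link kernel is Σ_λ (f^λ/|λ|!)² s_λ(spec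
JJ†)/d_λ (Bars1980, Balantekin2000), a
Loewner-monotone function of the colour-singlet Gram data, and for SU(3) the baryonic angle enters
through non-negative harmonics. What is
imported, with an explicit dictionary (spin ↦ auxiliary Gram matrix, ferromagnetic coupling ↦
Loewner-monotone log-kernel, inverse
temperature ↦ β through one Gaussian width, Griffiths II ↦ non-negative plaquette–plaquette
covariances (the former crux PlaquetteCovarianceNonneg, numerically refuted at rev 3),
high-temperature sharpness ↦ AllCouplingClustering,
critical point ↦ β = ∞): the correlation-inequality and sharpness technology of ferromagnets and
percolation (Ginibre1970,
FortuinKasteleynGinibre1971, Simon1980, Lieb1980, AizenmanBarskyFernandez1987,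
DuminilCopinTassionCMP2016), which has so far touched gauge
theories only for ℤ₂/U(1)/Potts (DeangelisDefalco1977, DeAngelisDeFalcoGuerra1978,
DuncanSchweinhart2025). Unlike worldline/abelian-colour-cycle
dualisations, nothing is expanded, so no sign problem is created in the gauge sector; unlike the
card, no universality crux is needed
because the dual is of the Statement's own Wilson scheme. The negatives index is empty; the sibling
YM route RandomConstraintAnnealing
(Edwards–Sokal tube conditioning) shares the FKG flavour but neither the object (it keeps the links)
nor any item. REV 3 (2026-08-16, route-repair): the finite-volume association leg of this dictionary
is numerically refuted (complementary-plane plaquette energies anticorrelate on the 2⁴ torus at β_W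
≥ 8; evidence on stmt-QuantumFields-9756/ -9712, two independent refuter codes); what survives is the
OBJECT (the exact link-free dual with positive, Loewner-monotone kernels) and the chain clustering →
physical gap → continuum, now wired into `closes` through the glue support LatticeGapAFOfClustering;
no replacement all-coupling engine is filed here (tenure decision).

RANKED CRUXES. #4 AllCouplingClustering (crux) — Lattice QCD with gauge group SU(3), Wilson gauge
action at ANY β ≥ 0 and N_f ≤ 3 Wilson quarks of strictly positive bare masses (κ < 1/8: the
positive-determinant, doubler-safe sector; N_f = 0 is pure Yang–Mills) clusters exponentially in
Euclidean time in lattice units, uniformly in the volume: there is μ(N_f, β, m) > 0 such that every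
pair A, B of gauge-invariant local lattice observables (Wilson loops, mesons, baryons) satisfies
‖⟨A·τ_n B⟩ − ⟨A⟩⟨B⟩‖ ≤ C_AB e^(−μ n) on every torus (2S+1)⁴, n ≤ S. It was to be the dual engine's
deliverable (Simon–Lieb finite-volume criterion and ABF/DCT sharpness for a positively associated
link-free dual, plus absence of a dual ordering transition at every finite β on the SYMMETRIC
four-torus); after rev 3 the association input is numerically refuted in finite volume and NO engine
for this crux is in hand — it stands as the bare all-coupling clustering conjecture over the dual
object. Feeds X through the glue LatticeGapAFOfClustering. [deps: none] [difficulty: open-problem]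
(why it might fail: No engine after rev 3 — the finite-volume association that Simon–Lieb / ABF /
DCT sharpness presupposes is numerically refuted; contains 'SU(3) lattice Yang–Mills has a mass gap
at every β' (Chatterjee's Problem 5.1, open; its U(1) analogue is false, Guth1980); a critical
endpoint of a bulk first-order line ON the Wilson axis would refute it.) [ChatterjeeYMProb2019,
Simon1980, Lieb1980, AizenmanBarskyFernandez1987, DuminilCopinTassionCMP2016, BorgsSeiler1983,
OsterwalderSeiler1978, Guth1980]
#5 LatticeQCDGapAF (crux) — X, the lattice half of QCDOf 2 ∧ QCDOf 3: for N_f = 2 and N_f = 3 there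
is a mass-independent regularisation reg (a_k → 0; β_k with two-loop asymptotic scaling; a_k L_k →
∞; m_crit(k); Z_m(k) with leading-log mass scaling) such that for every tuple of positive
renormalised masses the bare trajectory m_f(k) = m_crit(k) + a_k m_f/Z_m(k) stays on the physical
branch (> −1 eventually) and the Wilson lattice theories have a lattice mass gap Δ(m) > 0 in
PHYSICAL units, uniformly in the volume (`HasLatticeMassGap`, all gauge-invariant observables).
AllCouplingClustering supplies clustering at each k in lattice units (the Griffiths-type
monotonicity of masses in β claimed at open went with the refuted association leg); the RATE ξ(β_k)
≍ a_k⁻¹ (dimensional transmutation) is imported (cards femto-universe-step-scaling,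
bag-calculus-sharp-trajectory-transport, heavy-threshold-robust-ym-bridge) and the light-quark
signed sector from the determinant-sign cards. [deps: AllCouplingClustering,
LatticeGapAFOfClustering] [difficulty: open-problem] (why it might fail: It is the core of the
problem: sharpness gives a positive rate in lattice units at each β_k but no lower bound ≍ a_k·Δ
along β_k → ∞ (PerturbativeInvisibility); light Wilson quarks (m_f(k) < 0) leave the positive sector
(WilsonDeterminantSign) and skirt the Aoki region.) [JaffeWitten2000, MontvayMunster1994,
Balaban1988Convergent, BorgsSeiler1983, Tomboulis2007Confinement]
#6 ContinuumFromLatticeGap (crux) — The continuum / Osterwalder–Schrader half, shared with every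
lattice-first QCD line: a regularisation with exactly the package of LatticeQCDGapAF (asymptotic
scaling, mass scaling, physical branch, physical-unit lattice gap for every positive mass tuple)
yields QCDOf N_f for N_f = 2, 3 — OS data T for glue and the pseudoscalar bilinears with IsQCDAlong
(joint convergence of all lattice Schwinger functions along ONE sequence, for all m), E0–E4,
non-trivial and non-Gaussian glue, non-decoupled flavour-changing pseudoscalars, and T.HasMassGap Δ
by spectral transfer of the lattice gap (Lüscher transfer matrix, κ < 1/6). The dual contributes
site-reflection positivity of the (U, auxiliary, ψ) representation and Griffiths-I-type lower bounds
towards non-triviality; the rest is imported. [deps: LatticeQCDGapAF] [difficulty: open-problem]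
(why it might fail: One sequence must converge for uncountably many m (needs continuity in m or
uniqueness); O(4) restoration (E1) and non-Gaussianity of glue are open even given a gap
(RegularisationDichotomy, UVStabilityNonUniqueness); tightness of renormalised composites is not
implied by clustering.) [OsterwalderSeiler1978, Seiler1982, GlimmJaffe1987, JaffeWitten2000,
Luscher1977, MontvayMunster1994]
#9 LatticeGapAFOfClustering (support, glue; stmt-QuantumFields-14979, filed rev 3) —
AllCouplingClustering → LatticeQCDGapAF: the cone edge that makes AllCouplingClustering feed the
deciding theorem (`closes (hG hA) hC`). Conjecture-grade, not routine: it carries the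
dimensional-transmutation RATE from above — an upper bound ξ(β_k, m(k)) ≤ (Δ a_k)⁻¹ on every
gauge-invariant correlation length along a two-loop trajectory, with k-uniform prefactors — and the
bare-mass trajectory question (honest chiral line m_crit(k) < 0 leaves the positive-mass sector of
AllCouplingClustering; m_crit ≡ 0 stays inside but decouples the quarks and starves
ContinuumFromLatticeGap). [difficulty: open-problem] (why it might fail: with true antecedent it
fails iff some correlation length outgrows the two-loop profile on every admissible mass trajectory,
ξ·a_k → ∞ — Patrascioiu–Seiler — or prefactors are not k-uniform.) [JaffeWitten2000,
MontvayMunster1994, PatrascioiuSeiler1995, Seiler2003, Balaban1988Convergent]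
#9 OneLinkLoewnerMonotoneU3 (support) — Loewner monotonicity of the U(3) one-link
(Brézin–Gross–Witten / Bars) integral W(J) = ∫_U(3) e^(2Re tr JU) dU: if JJ† ≤ KK† then W(J) ≤ W(K).
Proof route: W(J) = Σ_λ (f^λ/|λ|!)² s_λ(spec JJ†)/d_λ over partitions with ≤ 3 rows (character
expansion of e^(tr A) = Σ_λ (f^λ/|λ|!) s_λ(A) and Schur orthogonality ∫ χ_λ(AU) conj χ_μ(BU) dU =
δ_λμ χ_λ(AB†)/d_λ), Schur functions are monomial-positive, and Weyl monotonicity of sorted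
eigenvalues under Loewner order; the structure theorem behind card P1(b). [difficulty: provable-now]
[Bars1980, Balantekin2000, ErikssonSvartholmSkagerstam1981]
#9 BaryonicHarmonicsNonneg (support) — The baryonic harmonics of the SU(3) one-link integral are
non-negative: for q ∈ ℕ and s ∈ ℝ³ with s_i ≥ 0, I_q(s) = ∫_U(3) Re(det U)^q · e^(2 Σ_i s_i Re U_ii)
dU ≥ 0; indeed I_q(s) = (s₁s₂s₃)^q Σ_λ c_λ c_(λ+q³) s_λ(s²)/d_λ with c_λ = f^λ/|λ|! > 0 (det^q χ_λ =
χ_(λ+q³) and Schur orthogonality), so W_SU(3)(J) = Σ_q∈ℤ e^(−iq arg det J) w_q(sv J) is a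
positive-definite function of the baryonic angle, maximal at det J > 0 and with each w_q increasing
in the singular values — card P2, with the total-positivity conjecture replaced by a character
identity. [difficulty: provable-now] [Balantekin2000, Bars1980, Creutz2022]
Dropped at rev 3 (route-repair, 2026-08-16) as numerically refuted and not load-bearing for
`closes`: the former rank-2 Griffiths-II crux (decl PlaquetteCovarianceNonneg,
stmt-QuantumFields-9712: Cov(Re tr U_p, Re tr U_q) ≥ 0 for all plaquette pairs on every (ℤ/L)⁴, L ≥
2, β ≥ 0 — false at L = 2, β_W ∈ {8,12,16,24} for complementary planes, −2.27(5)·10⁻⁴ at β_W = 12)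
and the informal rank-3 association crux (decl DualPositiveAssociation, stmt-QuantumFields-9756: its
minimal pair form is the former; its literal full-cone wording is trivially false). Ranks 2–3 are
left vacant on purpose: the hardest live bet is AllCouplingClustering (rank 4).

TWO-LAYER PLAN. Foreseen glued splits, filed only when a crux closes (k ≤ 3, depth 1). The split of
AllCouplingClustering drawn at open (DualPositiveAssociation → DualSimonLieb → NoDualTransitionOnZ4
→ AllCouplingClustering) is DEAD with the association leg (rev 3); a replacement engine is a tenure
matter (candidates, unfiled: the same order programme on 't Hooft-twisted tori, where the zero modes
that produce the negative complementary-plane covariances are absent, transferred to periodic tori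
in the thermodynamic limit; or thermodynamic-limit-first covariance inequalities). LatticeQCDGapAF ⇐
AllCouplingClustering → LatticeGapAFOfClustering → LatticeQCDGapAF is now FILED as the cone edge;
the glue's own foreseen split is SignedSectorClustering (light Wilson quarks, determinant-sign
cards) → AFRate (ξ(β_k)·a_k ≍ const, imported) → LatticeGapAFOfClustering. ContinuumFromLatticeGap ⇐
TightnessAndOS (RP of the (U, Q, R, ψ) representation, Kennedy–Lieb restriction) →
NontrivialityFromGriffithsI → ContinuumFromLatticeGap, unchanged.

KILL CRITERIA. EXECUTED at rev 3: the pre-declared falsifier fired — a negative plaquette–plaquette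
covariance for SU(3) (L = 2, β_W ≥ 8, complementary planes; refuters rattack-9756 gen 1–2, > 20σ /
49σ). The opener's clause 'if the witness needs L ≤ 3, restate with a volume floor' was NOT applied:
the refuters' mechanism (torus zero modes, O(β⁻²) per pair) predicts the same sign on every fixed
torus at large enough β, a property holding on 4⁴ but not on 2⁴ is not an order structure (no
Holley/FKG, Simon–Lieb or monotone limits from it), and a floor-restated covariance sign would feed
nothing in `closes`; both association items were dropped instead. REMAINING: a non-clustering point
(β ≥ 0, m > 0, N_f ≤ 3) — e.g. a critical endpoint on the Wilson axis — refutes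
AllCouplingClustering and closes the route `refuted:AllCouplingClustering`; LatticeGapAFOfClustering
refuted (a non-asymptotically-free continuum limit with finite ξ at every β) closes it likewise;
LatticeQCDGapAF or ContinuumFromLatticeGap refuted ⇒ the Statement itself is in doubt (shared with
all lattice-first lines; hand to the operator). With no all-coupling engine left, a tenure review
that finds no replacement should close the route `exhausted` (object-level supports can be
re-attached to a successor). `LatticeMassGapAllCouplings` proved elsewhere moots
AllCouplingClustering for N_f = 0 only.

NOT DECOMPOSED YET. The dual measure itself (definition requests below); a replacement engine for
AllCouplingClustering (see TWO-LAYER PLAN); the light-quark (signed determinant) extension and the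
AF rate inside LatticeGapAFOfClustering; which reading of X (honest chiral m_crit(k) < 0 versus the
decoupling m_crit ≡ 0 witness that the typed X admits) the route means — flagged for tenure; every
continuum leg. All are layer-2 children of the open-problem items.

CHEAPEST FALSIFIER. (i) WAS RUN (rev 3): the plaquette-covariance scan — refuter rreview-0815T14-4
(kit j001494–j001508), crux-attack rattack-9756 gen 1 (pure-python Metropolis + numpy jobs
j004562/j004652) and gen 2 (numpy Cabibbo–Marinari heatbath + over-relaxation, replica jackknife,
validated against the exact 2×2-torus character expansion; jobs j014800, j014916, j014966, j014879):
SU(3) Wilson 2⁴ at β_W ∈ {8,12,16,24} gives Cov(Re tr U_p, Re tr U_q) = −2.27(5)·10⁻⁴ (β_W = 12) for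
complementary planes and a failed Griffiths-II response test (14.8σ); 4⁴, 6⁴ at β_W ≤ 16: all
classes ≥ 0. It killed the association leg (items dropped). (ii) For what remains nothing cheap
exists: AllCouplingClustering, LatticeGapAFOfClustering, LatticeQCDGapAF, ContinuumFromLatticeGap
are open-problem grade; the cheapest informative check is numerical evidence for a bulk critical
point ON the Wilson axis with light positive-mass Wilson quarks (none known; the fundamental–adjoint
endpoint sits off-axis, Heller1995). (iii) Object level: a truncated character-expansion check of
OneLinkLoewnerMonotoneU3 / BaryonicHarmonicsNonneg (refuters already verified both TRUE on paper and
by Haar Monte Carlo).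

NUMBERS. SU(3) Wilson axis: crossover (specific-heat peak) at β_W ≈ 5.4–5.7, i.e. tree β ≈ 1.8–1.9;
no bulk transition on the axis (first-order
endpoint only in the fundamental–adjoint plane). Hopping parameter: positive bare mass ⟺ κ < 1/8;
free critical κ_c = 1/8, strong-coupling
κ_c(0) = 1/4; Lüscher positivity for κ < 1/6 (m > −1). One-link kernel: W_U(N)(J) = Σ_λ (f^λ/|λ|!)²
s_λ(spec JJ†)/d_λ; VdF Gaussian widths
γ_(3β/N)[Q], γ_(β/N)[R] before rescaling. Items at open: 8 (4 typed cruxes, 2 supports, assembly) +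
1 informal crux and 3 definition requests filed after open; rev 2 dropped the support
UnitaryGroupNotSimple; rev 3 (this repair) drops PlaquetteCovarianceNonneg and
DualPositiveAssociation and adds the glue support LatticeGapAFOfClustering
(stmt-QuantumFields-14979): 7 items = 3 cruxes (AllCouplingClustering r4, LatticeQCDGapAF r5,
ContinuumFromLatticeGap r6) + 3 supports + assembly. Measured (rev 3): 2⁴, β_W = 12: C_comp =
−2.268(46)·10⁻⁴ (cold −2.256(67), hot −2.275(61)·10⁻⁴; ≈ −0.033/β_W²); response ∂⟨Re tr
U_01⟩/∂β_W(23): raising β_W(23) from 9 to 15 at β_W = 12 elsewhere lowers ⟨Re tr U_01⟩ by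
7.4(5)·10⁻³; 4⁴ β_W = 12 complementary-vertex class +1.0(2)·10⁻⁴; 6⁴ β_W = 5.7: +3.7(1)·10⁻³, ⟨P⟩/3
= 0.5507(12).

DEFINITION REQUESTS. D1 `oneLinkIntegral` (SU(N) and U(N): J ↦ ∫ e^(2Re tr JU) dHaar) in
Literature/MathematicalPhysics/QuantumLattice with the structure facts
above as theorems; D2 `vdfDualMeasure β L` — the Vairinhos–de Forcrand link-free law of the
auxiliary fields (Q_p, R_p, R'_p ∈ M₃(ℂ) per
plaquette of the 4-torus: Gaussian densities × ∏_links W_SU(3)(J_ℓ), J_ℓ the sum over the six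
plaquettes containing ℓ of R_pQ_p†, R_p†,
R'_pQ_p† or R'_p† according to the role of ℓ in p) posited for this problem
(Summits/QuantumFields/QCD/Theorems), together with the
CONSTRUCTION statement 'Z_Wilson(β_•) = N₀ ∫ dvdfDualMeasure' and the source dictionary for Wilson
loops; D3 `IsLoewnerAssociated` —
positive association of a probability measure on a finite product of matrix spaces with respect to
bounded functionals non-decreasing in
each Q_pQ_p† (Loewner order). After rev 3 no live item depends on D3 (`IsLoewnerAssociated`; the
association crux it served is dropped — the operator may retire the request); D1/D2 remain wanted
for the dual OBJECT (the construction statement 'Z_Wilson = N₀ ∫ dvdfDualMeasure' and the source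
dictionary) should a tenure pivot re-use it, but nothing in `closes` waits on them.

Novelty: Searches (2026-08-15): `lit search` local index unavailable (searchd rc 75, ×3); `lit search
--source zbmath "Griffiths inequalities lattice
gauge"` (4: Orland 2020 ℤ₂ all-coupling confinement, gauge glasses 2026, abelian bootstrap — nothing
non-abelian); `--source crossref "De Angelis
de Falco Guerra correlation inequalities lattice gauge fields"` (10: the 1977–78 abelian papers);
`--source crossref "sharp phase transition
lattice gauge theory Potts Duncan Schweinhart"` (DuncanSchweinhart2025, Potts only); `--source
crossref "induced QCD … Brandt Lohmayer Wettig"`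
(BLW I/II, proceedings); `--source crossref "Bars U(N) integral generating functional"` (Bars1980,
Fateev–Onofri 1981); `lit galaxy search
"one-link integral" --star all` (12 rows: Meyer-Ortmanns–Reisz, Makeenko, worldline/strong-coupling
QCD papers — elimination at β = 0 only);
`lit galaxy search --star pdf --mode bm25` on GKS for non-abelian LGT (20 rows, none on correlation
inequalities); `lit vsearch` on GKS/plaquette
covariance positivity (textbooks only: Glimm–Jaffe p. 337 → abelian); `lit frontier QuantumFields
--since 2020` (30 rows; arXiv:2605.02156
survey grepped: no GKS/FKG); `lit read arXiv:1409.8442` in full.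
Nearest prior art found: VairinhosDeforcrand2014 (arXiv:1409.8442: exact elimination of all links of
the Wilson action by HS auxiliaries,
as a simulation device; no structure theorem, no inequalities); BudcziesZirnbauer2003 +
BrandtLohmayerWettig2016 (induced weight, announced
dual); Bars1980 / Ba  [refs: 2605.02156, 1409.8442, DuncanSchweinhart2025, Bars1980, VairinhosDeforcrand2014, BudcziesZirnbauer2003, BrandtLohmayerWettig2016, Balantekin2000, DeangelisDefalco1977, DeAngelisDeFalcoGuerra1978]

Barriers (technique_class: link-integration-duality, correlation-inequalities): - technique_class: link-integration-duality, correlation-inequalities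
- Literature.Barriers.QuantumFields.MigdalKadanoffGroupBlindness: the engine is group-sensitive by
construction — the dual kernels, harmonics and the location of the dual critical point depend on G;
for U(1) the same elimination gives a Ginibre ferromagnet WITH a finite dual critical point (the
Coulomb transition), so the argument cannot prove too much.
- Literature.Barriers.QuantumFields.AbelianDeconfinementD4: AllCouplingClustering is claimed for
SU(3) only; its U(1) analogue is false (Guth1980, FrohlichSpencerCMP1982) and the bet 'no dual
transition before β = ∞' is exactly the SU(3)-specific statement a refuter can test.
- Literature.Barriers.QuantumFields.FiniteTemperatureDeconfinement: all clustering claims are on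
SYMMETRIC tori (2S+1)⁴ at fixed β, uniform in S (zero-temperature geometry); at fixed temporal
extent the dual must and does allow an ordering transition (Borgs–Seiler), so NoDualTransitionOnZ4
has to use the four-torus geometry — conceded as the hard core of AllCouplingClustering.
- Literature.Barriers.QuantumFields.ElitzurTheorem: moot — no gauge variables remain; dual
observables are local invariants (Gram data, baryonic angles); every live item quantifies over
gauge-invariant observables only.
- Literature.Barriers.QuantumFields.WilsonDeterminantSign: positivity of the Berezin-integrated dual
weight holds for bare masses > 0 (κ < 1/8) and degenerate pairs only; AllCouplingClustering is p

Novelty grade: new-combination — ROUTE REVIEW (refuter rreview-0815T14-4). new-combination: exact link elimination of the WILSON action (VairinhosDeforcrand2014, a simulation device; induced-weight cousins BudcziesZirnbauer2003/BrandtLohmayerWettig2016) + correlation-inequality/sharpness technology (Ginibre, FKG, Simon–Lieb, ABF198 (refuter refuter-rreview-0815T14-4-0, 2026-08-15T15:02:23Z; prior: VairinhosDeforcrand2014, Bars1980, DeAngelisDeFalcoGuerra1978, DuncanSchweinhart2025, AizenmanBarskyFernandez1987)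

History (route lifecycle, newest last):
- 2026-08-15T16:14:08Z · rev 2: dropped UnitaryGroupNotSimple — route-repair g2 (cone): drop support UnitaryGroupNotSimple (stmt-QuantumFields-9774) from GluonFreeDual — not load-bearing: the deciding theorem closes : Lattic (planner-rrepair-QuantumFields-GluonFreeDual-80c08fcf-g2-0)
- 2026-08-16T04:15:40Z · AUTO-CRUX (backfill): LatticeQCDGapAF — hypotheses of the deciding theorem that nothing in the route derives are cruxes (operator:999:1085951)
- 2026-08-16T07:04:05Z · rev 3: dropped DualPositiveAssociation, PlaquetteCovarianceNonneg — @note.txt (planner-rrepair-QuantumFields-GluonFreeDual-un-d49cab69-0)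
- 2026-08-16T07:22:03Z · CLOSED retired — engine refuted in substance (evidence-level, no Lean theorem possible for a 64-link integral): stmt-QuantumFields-9756 DualPositiveAssociation refuted-substantive by rattack-9756 gen-1/gen-2 Monte Car (planner-rchoice-QuantumFields-GluonFreeDual-st-b2bb7bf8-0)

sub-problem: QCD · status: closed(retired) · opened planner-plancard-QuantumFields-QCD-gluon-free-acaef280-0 2026-08-15T14:15:26Z · rev 6 · ledger route-QuantumFields-GluonFreeDual
GENERATED by the gate from the ledger (D-0016/17). Provers cite these decls: `theorem foo : Summit.QuantumFields.QCD.Theses.GluonFreeDual.<Decl> := …` in Summits/QuantumFields/QCD/Theorems/<Name>.lean.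
-/

namespace Summit.QuantumFields.QCD.Theses.GluonFreeDual

open scoped BigOperators Topology Manifold Classical MeasureTheory ProbabilityTheory Matrix InnerProductSpace ComplexConjugate ContinuousMap
open Filter Set Function TopologicalSpace MeasureTheory

attribute [summit_statement] _root_.QCD

/-- item stmt-QuantumFields-9713 · crux · rank 4 · closed · moot by None · by planner
why it might fail: For N_f=0 it is 'SU(3) lattice YM has a mass gap at every β' (Chatterjee Problem 5.1, open; U(1) analogue false, Guth1980). The fundamental–adjoint bulk line ends in a critical endpoint with m(0++)→0 (Heller1995, β_a≈2 numerically); were it or a first-order point ON the Wilson axis, it fails.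
sources: ChatterjeeYMProb2019, Heller1995, Guth1980, FrohlichSpencerCMP1982, Simon1980, Lieb1980
[crux] Lattice QCD with gauge group SU(3), Wilson gauge action at ANY β ≥ 0 and N_f ≤ 3 Wilson
quarks of strictly positive bare masses (κ < 1/8: the positive-determinant, doubler-safe sector; N_f
= 0 is pure Yang–Mills) clusters exponentially in Euclidean time in lattice units, uniformly in the
volume: there is μ(N_f, β, m) > 0 such that every pair A, B of gauge-invariant local lattice
observables (Wilson loops, mesons, baryons) satisfies ‖⟨A·τ_n B⟩ − ⟨A⟩⟨B⟩‖ ≤ C_AB e^(−μ n) on every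
torus (2S+1)⁴, n ≤ S. This is the dual engine's deliverable: Simon–Lieb finite-volume criterion and
ABF/DCT sharpness for the positive link-free dual, plus absence of a dual ordering transition at
every finite β on the SYMMETRIC four-torus (the zero-temperature geometry; at fixed temporal extent
Borgs–Seiler force one). [deps: PlaquetteCovarianceNonneg] [difficulty: open-problem] -/
@[route_item "route-QuantumFields-GluonFreeDual"]
def AllCouplingClustering : Prop :=
  ∀ (Nf : ℕ), Nf ≤ 3 → ∀ β : ℝ, 0 ≤ β → ∀ mq : Fin Nf → ℝ, (∀ f, 0 < mq f) → ∃ μ : ℝ, 0 < μ ∧ ∀ (R R' : ℕ) (A : Literature.MathematicalPhysics.QuantumFieldTheory.QCDLatticeObservable Nf R) (B : Literature.MathematicalPhysics.QuantumFieldTheory.QCDLatticeObservable Nf R'), ∃ C : ℝ, ∀ S n : ℕ, n ≤ S → ‖Literature.MathematicalPhysics.QuantumFieldTheory.qcdLatticeConnectedCorr β (2 * S + 1) mq A B n‖ ≤ C * Real.exp (-(μ * n))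

/-- item stmt-QuantumFields-9714 · crux (kind.auto-crux: conjecture-grade) · rank 5 · closed · moot by None · by planner
why it might fail: Fails if lattice SU(3)+Wilson quarks is not asymptotically free beyond perturbation theory (PatrascioiuSeiler1995, Seiler2003: ξ=∞ at finite β) or the gap is not uniform in physical units along β_k→∞ (sharpness gives lattice-unit rates only: PerturbativeInvisibility); light m_f(k)<0 are signed.
sources: JaffeWitten2000, MontvayMunster1994, PatrascioiuSeiler1995, Seiler2003, Balaban1988Convergent, SharpeSingleton1998
[crux] X, the lattice half of QCDOf 2 ∧ QCDOf 3: for N_f = 2 and N_f = 3 there is a mass-independent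
regularisation reg (a_k → 0; β_k with two-loop asymptotic scaling; a_k L_k → ∞; m_crit(k); Z_m(k)
with leading-log mass scaling) such that for every tuple of positive renormalised masses the bare
trajectory m_f(k) = m_crit(k) + a_k m_f/Z_m(k) stays on the physical branch (> −1 eventually) and
the Wilson lattice theories have a lattice mass gap Δ(m) > 0 in PHYSICAL units, uniformly in the
volume (`HasLatticeMassGap`, all gauge-invariant observables). The dual supplies clustering at each
k and one-sided (Griffiths-type) monotonicity of masses in β; the RATE ξ(β_k) ≍ a_k⁻¹ (dimensional
transmutation) is imported (cards femto-universe-step-scaling,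
bag-calculus-sharp-trajectory-transport, heavy-threshold-robust-ym-bridge) and the light-quark
signed sector from the determinant-sign cards. [deps: AllCouplingClustering] [difficulty:
open-problem] -/
@[route_item "route-QuantumFields-GluonFreeDual"]
def LatticeQCDGapAF : Prop :=
  ∀ Nf : ℕ, (Nf = 2 ∨ Nf = 3) → ∃ reg : Literature.MathematicalPhysics.QuantumFieldTheory.QCDRegularisation Nf, reg.HasMassScaling ∧ (∀ (m : Fin Nf → ℝ) (z shift : Literature.MathematicalPhysics.QuantumFieldTheory.QCDField Nf → ℕ → ℝ), (reg.scheme m z shift).HasAsymptoticScaling) ∧ ∀ m : Fin Nf → ℝ, (∀ f, 0 < m f) → (∀ f, ∀ᶠ k in Filter.atTop, -1 < (reg.scheme m 0 0).mq f k) ∧ ∃ Δ : ℝ, 0 < Δ ∧ ∀ z shift : Literature.MathematicalPhysics.QuantumFieldTheory.QCDField Nf → ℕ → ℝ, (reg.scheme m z shift).HasLatticeMassGap Δ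

/-- item stmt-QuantumFields-9715 · crux · rank 6 · closed · moot by None · by planner
why it might fail: One sequence must serve uncountably many m (continuity/uniqueness in m unproved); E1 (O(4)) restoration and non-Gaussian glue are open even given a gap (RegularisationDichotomy, UVStabilityNonUniqueness); clustering gives no tightness of renormalised composites; glue mixes with a⁻¹ψ̄ψ (audit g3 N1).
sources: OsterwalderSeiler1978, Seiler1982, GlimmJaffe1987, JaffeWitten2000, Luscher1977, MontvayMunster1994
[crux] The continuum / Osterwalder–Schrader half, shared with every lattice-first QCD line: a
regularisation with exactly the package of LatticeQCDGapAF (asymptotic scaling, mass scaling,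
physical branch, physical-unit lattice gap for every positive mass tuple) yields QCDOf N_f for N_f =
2, 3 — OS data T for glue and the pseudoscalar bilinears with IsQCDAlong (joint convergence of all
lattice Schwinger functions along ONE sequence, for all m), E0–E4, non-trivial and non-Gaussian
glue, non-decoupled flavour-changing pseudoscalars, and T.HasMassGap Δ by spectral transfer of the
lattice gap (Lüscher transfer matrix, κ < 1/6). The dual contributes site-reflection positivity of
the (U, auxiliary, ψ) representation and Griffiths-I-type lower bounds towards non-triviality; the
rest is imported. [deps: LatticeQCDGapAF] [difficulty: open-problem] -/
@[route_item "route-QuantumFields-GluonFreeDual"]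
def ContinuumFromLatticeGap : Prop :=
  ∀ Nf : ℕ, (Nf = 2 ∨ Nf = 3) → (∃ reg : Literature.MathematicalPhysics.QuantumFieldTheory.QCDRegularisation Nf, reg.HasMassScaling ∧ (∀ (m : Fin Nf → ℝ) (z shift : Literature.MathematicalPhysics.QuantumFieldTheory.QCDField Nf → ℕ → ℝ), (reg.scheme m z shift).HasAsymptoticScaling) ∧ ∀ m : Fin Nf → ℝ, (∀ f, 0 < m f) → (∀ f, ∀ᶠ k in Filter.atTop, -1 < (reg.scheme m 0 0).mq f k) ∧ ∃ Δ : ℝ, 0 < Δ ∧ ∀ z shift : Literature.MathematicalPhysics.QuantumFieldTheory.QCDField Nf → ℕ → ℝ, (reg.scheme m z shift).HasLatticeMassGap Δ) → QCDOf Nf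

/-- item stmt-QuantumFields-14979 · support · rank 9 · closed · moot by None · by planner
why it might fail: With true antecedent it fails iff on every admissible bare-mass trajectory some gauge-invariant correlation length outgrows the two-loop AF profile (ξ(β_k,m(k))·a_k → ∞: non-AF continuum limit, Patrascioiu–Seiler) or clustering prefactors are not k-uniform.
sources: JaffeWitten2000, MontvayMunster1994, PatrascioiuSeiler1995, Seiler2003, Balaban1988Convergent, Literature.Barriers.QuantumFields.PerturbativeInvisibility
[glue] Transport of all-coupling clustering to the physical-unit lattice gap — the route's layer-2
edge AllCouplingClustering ⇒ X = LatticeQCDGapAF, filed (route-repair rev 3) so that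
AllCouplingClustering feeds the deciding theorem: `closes (h_glue h_ACC) h_Cont : QCD`. CONTENT (not
routine, conjecture-grade): from a clustering rate μ(N_f, β, m) > 0 in LATTICE units at every β ≥ 0
and every tuple of positive bare masses, produce ONE mass-independent regularisation (a_k → 0, β_k
on the two-loop N_f-flavour profile afBeta, a_k L_k → ∞, m_crit(k), leading-log Z_m(k)) with μ(β_k,
m(k)) ≥ Δ·a_k for all large k and observable-wise prefactors C_AB uniform in k — i.e. an UPPER bound
ξ(β_k, m(k)) ≤ (Δ a_k)⁻¹ ≍ Λ⁻¹ e^{β_k/(4b₀)}·(two-loop power) on EVERY gauge-invariant correlation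
length along an asymptotically free trajectory (dimensional transmutation from above;
AllCouplingClustering alone gives finiteness of ξ at each β but no growth control), plus the
bare-mass trajectory: on the honest chiral line m_crit(k) < 0 the light bare masses leave
AllCouplingClustering's positive-mass sector (WilsonDeterminantSign; conceded to the
determinant-sign cards), whereas m_crit ≡ 0 stays inside it bu -/
@[route_item "route-QuantumFields-GluonFreeDual"]
def LatticeGapAFOfClustering : Prop :=
  AllCouplingClustering → LatticeQCDGapAF

/-- item stmt-QuantumFields-9716 · support · rank 9 · closed · moot by None · by planner
sources: Bars1980, Balantekin2000, ErikssonSvartholmSkagerstam1981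
[support] Loewner monotonicity of the U(3) one-link (Brézin–Gross–Witten / Bars) integral W(J) =
∫_U(3) e^(2Re tr JU) dU: if JJ† ≤ KK† then W(J) ≤ W(K). Proof route: W(J) = Σ_λ (f^λ/|λ|!)² s_λ(spec
JJ†)/d_λ over partitions with ≤ 3 rows (character expansion of e^(tr A) = Σ_λ (f^λ/|λ|!) s_λ(A) and
Schur orthogonality ∫ χ_λ(AU) conj χ_μ(BU) dU = δ_λμ χ_λ(AB†)/d_λ), Schur functions are
monomial-positive, and Weyl monotonicity of sorted eigenvalues under Loewner order; the structure
theorem behind card P1(b). [difficulty: provable-now] -/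
@[route_item "route-QuantumFields-GluonFreeDual"]
def OneLinkLoewnerMonotoneU3 : Prop :=
  open scoped ComplexOrder in ∀ J K : Matrix (Fin 3) (Fin 3) ℂ, (K * K.conjTranspose - J * J.conjTranspose).PosSemidef → (∫ U, Real.exp (2 * (J * (U : Matrix (Fin 3) (Fin 3) ℂ)).trace.re) ∂(Literature.MathematicalPhysics.QuantumFieldTheory.haarProbability (Matrix.unitaryGroup (Fin 3) ℂ))) ≤ ∫ U, Real.exp (2 * (K * (U : Matrix (Fin 3) (Fin 3) ℂ)).trace.re) ∂(Literature.MathematicalPhysics.QuantumFieldTheory.haarProbability (Matrix.unitaryGroup (Fin 3) ℂ))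

/-- item stmt-QuantumFields-9717 · support · rank 9 · closed · moot by None · by planner
sources: Balantekin2000, Bars1980, Creutz2022
[support] The baryonic harmonics of the SU(3) one-link integral are non-negative: for q ∈ ℕ and s ∈
ℝ³ with s_i ≥ 0, I_q(s) = ∫_U(3) Re(det U)^q · e^(2 Σ_i s_i Re U_ii) dU ≥ 0; indeed I_q(s) =
(s₁s₂s₃)^q Σ_λ c_λ c_(λ+q³) s_λ(s²)/d_λ with c_λ = f^λ/|λ|! > 0 (det^q χ_λ = χ_(λ+q³) and Schur
orthogonality), so W_SU(3)(J) = Σ_q∈ℤ e^(−iq arg det J) w_q(sv J) is a positive-definite function of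
the baryonic angle, maximal at det J > 0 and with each w_q increasing in the singular values — card
P2, with the total-positivity conjecture replaced by a character identity. [difficulty:
provable-now] -/
@[route_item "route-QuantumFields-GluonFreeDual"]
def BaryonicHarmonicsNonneg : Prop :=
  ∀ (q : ℕ) (s : Fin 3 → ℝ), (∀ i, 0 ≤ s i) → 0 ≤ ∫ U, ((U : Matrix (Fin 3) (Fin 3) ℂ).det ^ q).re * Real.exp (2 * (Matrix.diagonal (fun i => ((s i : ℝ) : ℂ)) * (U : Matrix (Fin 3) (Fin 3) ℂ)).trace.re) ∂(Literature.MathematicalPhysics.QuantumFieldTheory.haarProbability (Matrix.unitaryGroup (Fin 3) ℂ))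

/-- item stmt-QuantumFields-9718 · assembly · rank 1 · closed · proved by Summit.QuantumFields.QCD.Theorems.gluonFreeDualAssembly_proof @ 4e243fb852f1 (prover) · by planner
sources: JaffeWitten2000, OsterwalderSeiler1978
[assembly] LatticeQCDGapAF → ContinuumFromLatticeGap → QCD (instantiate N_f = 2, 3 and pair). -/
@[route_item "route-QuantumFields-GluonFreeDual"]
def Assembly : Prop :=
  LatticeQCDGapAF → ContinuumFromLatticeGap → QCD

end Summit.QuantumFields.QCD.Theses.GluonFreeDual
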